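import Mathlib.Data.Finsupp.Weight
import Mathlib.Algebra.MvPolynomial.Basic
import HarnessLib

/-!
# Generic integral weights separating finitely many exponent vectors (instrument for the `W(f)` toy model — NOT a resolution theorem)

Engine 1 of the RESOLUTION OBSERVATORY toy model `W(f)` (cell `pub-rosobs`; RE-DERIVATION-eng1-g43 §3.11 (L1′),
CARVER-NOTES-eng1-g43 §2b, LEMMA `generic_weight` of target T106) needs the following elementary fact ("Kronecker
substitution"; it is the injectivity half of the statement that the lexicographic order on a FINITE set of monomials is
induced by one positive integral weight vector [GreuelPfister2002, Lemma 1.2.11, Example 1.2.12]):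

* `exists_pos_weight_injOn` — for every finite set `E` of exponent vectors `ι →₀ ℕ` there is a weight `λ : ι → ℕ` with
  ALL `λ i > 0` such that `e ↦ ⟨λ, e⟩ = Finsupp.weight λ e` is injective on `E`;
* `exists_generic_weight` — the engine's form: given finite `E₁`, `E₂` and `p : ℕ`, one positive `λ` is injective on `E₁`,
  injective on `E₂`, and separates `p • E₁` from `E₂` except at equal vectors (`⟨λ, p e₁⟩ = ⟨λ, e₂⟩ → p • e₁ = e₂`);
* `exists_pos_weight_injOn_biUnion_support` — the same for the monomials of finitely many polynomials.

Proof: induction on a finite set of indices carrying the supports; the new index gets the weight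
`M = 1 + max_E ⟨λ', ·⟩`, and `⟨λ, e⟩ = e a · M + ⟨λ', e.erase a⟩` is decoded by division with remainder.

VALUE: bookkeeping for a toy model (Resolution Observatory cell `pub-rosobs`, carver lane gen 64; AI-written Lean, and AI
review is weaker than expert review); NOT a statement about the invariant of [AbramovichTemkinWlodarczyk2024], NOT
progress on the summit.  The mathematics is textbook [GreuelPfister2002, §1.2]; only the packaging is ours.
-/

namespace Literature.AlgebraicGeometry.Resolution.WeightedBlowup.GenericWeight

open Finsupp

variable {ι : Type*}

/-- The weight `⟨w, f⟩` only depends on the values of `w` on the support of `f` (plumbing).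
[cite: GreuelPfister2002, Lemma 1.2.11] -/
theorem weight_congr {w₁ w₂ : ι → ℕ} {f : ι →₀ ℕ} (h : ∀ i ∈ f.support, w₁ i = w₂ i) :
    weight w₁ f = weight w₂ f := by
  rw [weight_apply, weight_apply, Finsupp.sum, Finsupp.sum]
  exact Finset.sum_congr rfl fun i hi => by rw [h i hi]

/-- Decoding formula: with the weight of `a` updated to `M`, `⟨λ, e⟩ = e a · M + ⟨λ', e.erase a⟩` (derived here).
[cite: GreuelPfister2002, Example 1.2.12] -/
theorem weight_update_eq [DecidableEq ι] (w : ι → ℕ) (a : ι) (M : ℕ) (e : ι →₀ ℕ) :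
    weight (Function.update w a M) e = e a * M + weight w (e.erase a) := by
  conv_lhs => rw [← Finsupp.single_add_erase a e]
  rw [map_add, weight_single, smul_eq_mul, Function.update_self]
  congr 1
  apply weight_congr
  intro i hi
  rw [Finsupp.support_erase, Finset.mem_erase] at hi
  exact Function.update_of_ne hi.1 _ _

/-- Inductive core (derived here): if the supports of the finitely many exponent vectors `E` lie in the finite index set `s`,
there is an everywhere-positive weight injective on `E`. [cite: GreuelPfister2002, Lemma 1.2.11, Example 1.2.12] -/
theorem exists_pos_weight_injOn_of_support_subset [DecidableEq ι] (s : Finset ι) :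
    ∀ E : Finset (ι →₀ ℕ), (∀ e ∈ E, e.support ⊆ s) →
      ∃ w : ι → ℕ, (∀ i, 0 < w i) ∧ Set.InjOn (weight w) (E : Set (ι →₀ ℕ)) := by
  induction s using Finset.induction_on with
  | empty =>
    intro E hE
    refine ⟨fun _ => 1, fun _ => Nat.one_pos, fun e₁ h₁ e₂ h₂ _ => ?_⟩
    have h0 : ∀ e ∈ E, e = 0 := fun e he =>
      Finsupp.support_eq_empty.mp (Finset.subset_empty.mp (hE e he))
    rw [h0 e₁ h₁, h0 e₂ h₂]
  | insert a s ha ih =>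
    intro E hE
    obtain ⟨w', hw'pos, hw'inj⟩ := ih (E.image (Finsupp.erase a)) (by
      intro e' he'
      obtain ⟨e, he, rfl⟩ := Finset.mem_image.mp he'
      rw [Finsupp.support_erase]
      intro i hi
      rw [Finset.mem_erase] at hi
      have := hE e he hi.2
      rw [Finset.mem_insert] at this
      exact this.resolve_left hi.1)
    set M : ℕ := E.sup (fun e => weight w' (e.erase a)) + 1 with hM
    have hlt : ∀ e ∈ E, weight w' (e.erase a) < M := fun e he =>
      Nat.lt_succ_of_le (Finset.le_sup (f := fun e => weight w' (e.erase a)) he)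
    refine ⟨Function.update w' a M, fun i => ?_, fun e₁ h₁ e₂ h₂ h => ?_⟩
    · rcases eq_or_ne i a with rfl | hi
      · rw [Function.update_self]; omega
      · rw [Function.update_of_ne hi]; exact hw'pos i
    · rw [Finset.mem_coe] at h₁ h₂
      rw [weight_update_eq, weight_update_eq] at h
      -- division with remainder by `M` decodes the pair (`e a`, `⟨λ', e.erase a⟩`)
      have hr : weight w' (e₁.erase a) = weight w' (e₂.erase a) := by
        have := congrArg (· % M) h
        simpa [Nat.mul_add_mod, Nat.mod_eq_of_lt (hlt e₁ h₁), Nat.mod_eq_of_lt (hlt e₂ h₂), Nat.mul_comm] using this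
      have hq : e₁ a = e₂ a := by
        have hM : 0 < M := by omega
        have h' : e₁ a * M = e₂ a * M := by omega
        exact Nat.eq_of_mul_eq_mul_right hM h'
      have herase : e₁.erase a = e₂.erase a :=
        hw'inj (Finset.mem_coe.mpr (Finset.mem_image_of_mem _ h₁)) (Finset.mem_coe.mpr (Finset.mem_image_of_mem _ h₂)) hr
      rw [← Finsupp.single_add_erase a e₁, ← Finsupp.single_add_erase a e₂, hq, herase]

/-- **Generic positive weight** (derived here): for every finite set `E` of exponent vectors there is an integral weight
`λ` with all `λ i > 0` whose pairing `e ↦ ⟨λ, e⟩` is injective on `E` ("Kronecker substitution"; the injectivity half of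
[GreuelPfister2002, Lemma 1.2.11 / Example 1.2.12]: the lexicographic order on a finite set of monomials is a weight order).
[cite: GreuelPfister2002, Lemma 1.2.11, Example 1.2.12] -/
theorem exists_pos_weight_injOn (E : Finset (ι →₀ ℕ)) :
    ∃ w : ι → ℕ, (∀ i, 0 < w i) ∧ Set.InjOn (weight w) (E : Set (ι →₀ ℕ)) := by
  classical
  exact exists_pos_weight_injOn_of_support_subset (E.biUnion Finsupp.support) E
    (fun e he => Finset.subset_biUnion_of_mem Finsupp.support he)

/-- `⟨λ, p • e⟩ = p · ⟨λ, e⟩` (plumbing). [cite: GreuelPfister2002, Lemma 1.2.11] -/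
theorem weight_nsmul (w : ι → ℕ) (p : ℕ) (e : ι →₀ ℕ) : weight w (p • e) = p * weight w e := by
  rw [map_nsmul, smul_eq_mul]

/-- **LEMMA `generic_weight`** in the engine's form (RE-DERIVATION-eng1-g43 §3.11 (L1′); derived here): for finite sets of
exponent vectors `E₁` ("`E_𝔇`"), `E₂` ("`E_q`") and `p : ℕ` there is ONE everywhere-positive integral weight `λ` that is
injective on `E₁`, injective on `E₂`, and separates `p • E₁` from `E₂` except at equal vectors.
[cite: GreuelPfister2002, Lemma 1.2.11, Example 1.2.12] -/
theorem exists_generic_weight [DecidableEq ι] (E₁ E₂ : Finset (ι →₀ ℕ)) (p : ℕ) :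
    ∃ w : ι → ℕ, (∀ i, 0 < w i) ∧ Set.InjOn (weight w) (E₁ : Set (ι →₀ ℕ)) ∧ Set.InjOn (weight w) (E₂ : Set (ι →₀ ℕ)) ∧
      ∀ e₁ ∈ E₁, ∀ e₂ ∈ E₂, weight w (p • e₁) = weight w e₂ → p • e₁ = e₂ := by
  obtain ⟨w, hwpos, hinj⟩ := exists_pos_weight_injOn (E₁ ∪ E₂ ∪ E₁.image (p • ·))
  have hsub₁ : (E₁ : Set (ι →₀ ℕ)) ⊆ ↑(E₁ ∪ E₂ ∪ E₁.image (p • ·)) := by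
    intro e he; simp only [Finset.coe_union, Finset.coe_image, Set.mem_union] at he ⊢; exact Or.inl (Or.inl he)
  have hsub₂ : (E₂ : Set (ι →₀ ℕ)) ⊆ ↑(E₁ ∪ E₂ ∪ E₁.image (p • ·)) := by
    intro e he; simp only [Finset.coe_union, Finset.coe_image, Set.mem_union] at he ⊢; exact Or.inl (Or.inr he)
  refine ⟨w, hwpos, hinj.mono hsub₁, hinj.mono hsub₂, fun e₁ h₁ e₂ h₂ h => hinj ?_ (hsub₂ (Finset.mem_coe.mpr h₂)) h⟩
  simp only [Finset.coe_union, Finset.coe_image, Set.mem_union, Set.mem_image, Finset.mem_coe]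
  exact Or.inr ⟨e₁, h₁, rfl⟩

/-- With an injective weight, EQUAL weights of two members of `E` mean equal exponents — the form in which (L1′) uses it
("the minimal `λ`-weight is attained by a unique monomial") (derived here; restatement of `Set.InjOn`).
[cite: GreuelPfister2002, Lemma 1.2.11] -/
theorem eq_of_weight_eq {w : ι → ℕ} {E : Finset (ι →₀ ℕ)} (h : Set.InjOn (weight w) (E : Set (ι →₀ ℕ)))
    {e₁ e₂ : ι →₀ ℕ} (h₁ : e₁ ∈ E) (h₂ : e₂ ∈ E) (heq : weight w e₁ = weight w e₂) : e₁ = e₂ :=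
  h (Finset.mem_coe.mpr h₁) (Finset.mem_coe.mpr h₂) heq

section Polynomials

variable {R : Type*} [CommSemiring R]

/-- The monomial version (derived here): for finitely many polynomials there is an everywhere-positive integral weight
injective on the union of their supports, so that every `λ`-homogeneous component of each of them is a single term.
[cite: GreuelPfister2002, Lemma 1.2.11, Example 1.2.12] -/
theorem exists_pos_weight_injOn_biUnion_support [DecidableEq ι] (F : Finset (MvPolynomial ι R)) :
    ∃ w : ι → ℕ, (∀ i, 0 < w i) ∧
      Set.InjOn (weight w) (F.biUnion MvPolynomial.support : Set (ι →₀ ℕ)) :=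
  exists_pos_weight_injOn _

/-- Consequence used for leading forms (derived here): if `λ` is injective on the support of `f`, then two monomials of `f`
of the same `λ`-weight coincide — each weighted-homogeneous component of `f` is a single term.
[cite: GreuelPfister2002, Lemma 1.2.11] -/
theorem eq_of_mem_support_of_weight_eq {w : ι → ℕ} {f : MvPolynomial ι R}
    (h : Set.InjOn (weight w) (f.support : Set (ι →₀ ℕ))) {d₁ d₂ : ι →₀ ℕ}
    (h₁ : d₁ ∈ f.support) (h₂ : d₂ ∈ f.support) (heq : weight w d₁ = weight w d₂) : d₁ = d₂ :=
  h (Finset.mem_coe.mpr h₁) (Finset.mem_coe.mpr h₂) heq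

end Polynomials

end Literature.AlgebraicGeometry.Resolution.WeightedBlowup.GenericWeight
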